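import Literature.NumberTheory.Automorphic.InvariantMeasureDomination
import HarnessLib

/-!
# Domination of orbit integrals with an explicit constant

Topic `NumberTheory/Automorphic`; namespace `Literature.NumberTheory.Automorphic`. Sequel to
`InvariantMeasureDomination` (abstract measure theory, Mathlib only). There, for a group `G` acting
on `X` with a finite invariant measure `μ` positive on open sets, a left-invariant `ν` on `G` and a
point `x₀` with open orbit map, it is proved that for every *compact* `D ⊆ G` there is *some* finite
`C` with `ν(D ∩ A_{x₀}(E)) ≤ C μ(E)` (`A_x(E) = {h | h⁻¹ • x ∈ E}`), whence
`∫_D F(θ h⁻¹ • x₀) dν(h) ≤ C ∫_X F dμ` uniformly in `θ`.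

The mean-square method towards Jacquet–Shalika's Thm. (5.3) (`JacquetShalikaSchurSelfSum`,
`WhittakerCoeffCuspidal`) integrates `|φ|²` over regions `D_X ⊆ GL_n(𝔸_K)` which *grow* with a
parameter `X` (torus boxes conjugating a unipotent box), and needs to know **how** the constant
depends on `D`: it is `ν(closure (B' D)) / μ(B'° • x₀)` for one fixed neighbourhood `B'` of `1` —
essentially the Haar measure of `D` itself, the thickening by `B'` being harmless for such boxes —
so that the growth `≍ X` of the constant is compensated by the Jacobian of the torus action. This
file extracts that explicit form from the proof of `exists_measure_inter_invOrbitPreimage_le`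
(same argument: left invariance of `ν` and the averaging identity
`∫_X ν(B ∩ A_x(E)) dμ = ν(B) μ(E)`), for **arbitrary** `D ⊆ G` (no compactness or measurability
needed; the bound is trivial when `ν(closure (B' D)) = ∞`):

* `measure_inter_invOrbitPreimage_le_mul` — `ν(D ∩ A_{x₀}(E)) ≤ (ν(closure (B' D)) / μ(U)) μ(E)`
  with `U = B'° • x₀`, for every `B' ∈ 𝓝 1`, every `D` and every measurable `E`;
* `measure_orbitNhd_pos` — `0 < μ(U)`;
* `lintegral_smul_inv_smul_le_mul`, `integral_smul_inv_smul_le_mul` — the integral forms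
  `∫_D F(θ h⁻¹ • x₀) dν(h) ≤ (ν(closure (B' D)) / μ(U)) ∫_X F dμ`, uniformly in `θ ∈ G`.

All statements proved; folklore (quasi-invariance of the invariant measure class on a homogeneous
space, as in `InvariantMeasureDomination`).
-/

noncomputable section

open MeasureTheory Measure Set Filter Topology
open scoped ENNReal Pointwise

namespace Literature.NumberTheory.Automorphic

section Explicit

variable {G X : Type*} [Group G] [TopologicalSpace G] [IsTopologicalGroup G]
  [MeasurableSpace G] [BorelSpace G]
  [MulAction G X] [MeasurableSpace X] [MeasurableSMul₂ G X]
  (μ : Measure X) (ν : Measure G)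
  [TopologicalSpace X] [OpensMeasurableSpace X]
  [IsFiniteMeasure μ] [SFinite ν] [SMulInvariantMeasure G X μ]
  [μ.IsOpenPosMeasure] [ν.IsMulLeftInvariant]

omit [IsTopologicalGroup G] [MeasurableSpace G] [BorelSpace G] [MeasurableSMul₂ G X]
  [OpensMeasurableSpace X] [IsFiniteMeasure μ] [SFinite ν] [SMulInvariantMeasure G X μ]
  [ν.IsMulLeftInvariant] in
/-- The orbit neighbourhood `U = B'° • x₀` of `x₀` has positive measure, for `B' ∈ 𝓝 1` and an open
orbit map (it is open and contains `x₀`). [folklore] -/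
theorem measure_orbitNhd_pos {x₀ : X} (hx₀ : IsOpenMap fun g : G => g • x₀) {B' : Set G}
    (hB'1 : B' ∈ 𝓝 (1 : G)) : 0 < μ ((fun g : G => g • x₀) '' interior B') := by
  refine (hx₀ _ isOpen_interior).measure_pos μ ⟨(1 : G) • x₀, 1, ?_, rfl⟩
  exact mem_interior_iff_mem_nhds.2 hB'1

/-- **Domination at a base point, with its constant.** Let `μ` be finite, invariant and positive on
non-empty open sets, `ν` left invariant, the orbit map of `x₀` open, and `B'` any neighbourhood of
`1` in `G`; put `U = B'° • x₀`. Then for **every** `D ⊆ G` and every measurable `E ⊆ X`,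
`ν(D ∩ A_{x₀}(E)) ≤ (ν(closure (B' D)) / μ(U)) μ(E)`.
Proof: for `x = b • x₀`, `b ∈ B'°`, left invariance gives
`ν(D ∩ A_{x₀}(E)) = ν(b D ∩ A_x(E)) ≤ ν(closure (B' D) ∩ A_x(E))`; average over `x ∈ U` and use the
averaging identity `∫_X ν(B ∩ A_x(E)) dμ = ν(B) μ(E)` (`lintegral_measure_inter_invOrbitPreimage`).
This is the constant implicit in `exists_measure_inter_invOrbitPreimage_le`. [folklore] -/
theorem measure_inter_invOrbitPreimage_le_mul {x₀ : X} (hx₀ : IsOpenMap fun g : G => g • x₀)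
    {B' : Set G} (hB'1 : B' ∈ 𝓝 (1 : G)) (D : Set G) {E : Set X} (hE : MeasurableSet E) :
    ν (D ∩ invOrbitPreimage x₀ E) ≤
      ν (closure (B' * D)) / μ ((fun g : G => g • x₀) '' interior B') * μ E := by
  set U : Set X := (fun g : G => g • x₀) '' interior B' with hU_def
  have hUo : IsOpen U := hx₀ _ isOpen_interior
  have hUpos : μ U ≠ 0 := (measure_orbitNhd_pos μ hx₀ hB'1).ne'
  have hUtop : μ U ≠ ∞ := measure_ne_top μ U
  set B : Set G := closure (B' * D) with hB_def
  have hBm : MeasurableSet B := isClosed_closure.measurableSet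
  -- the pointwise inequality on `U`, by left invariance of `ν`
  have hkey : ∀ x ∈ U, ν (D ∩ invOrbitPreimage x₀ E) ≤ ν (B ∩ invOrbitPreimage x E) := by
    rintro _ ⟨b, hb, rfl⟩
    have hbB' : b ∈ B' := interior_subset hb
    rw [invOrbitPreimage_smul]
    calc ν (D ∩ invOrbitPreimage x₀ E)
        = ν ((fun h : G => b⁻¹ * h) ⁻¹' (D ∩ invOrbitPreimage x₀ E)) :=
          (measure_preimage_mul ν b⁻¹ _).symm
      _ ≤ ν (B ∩ (fun h : G => b⁻¹ * h) ⁻¹' invOrbitPreimage x₀ E) := by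
          refine measure_mono fun h hh => ⟨subset_closure ?_, hh.2⟩
          exact ⟨b, hbB', b⁻¹ * h, hh.1, by simp⟩
  -- average over `U`
  calc ν (D ∩ invOrbitPreimage x₀ E)
      = (ν (D ∩ invOrbitPreimage x₀ E) * μ U) / μ U := by
        rw [mul_div_assoc, ENNReal.div_self hUpos hUtop, mul_one]
    _ = (∫⁻ _ in U, ν (D ∩ invOrbitPreimage x₀ E) ∂μ) / μ U := by
        rw [setLIntegral_const]
    _ ≤ (∫⁻ x in U, ν (B ∩ invOrbitPreimage x E) ∂μ) / μ U :=
        ENNReal.div_le_div_right (setLIntegral_mono' hUo.measurableSet hkey) _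
    _ ≤ (∫⁻ x, ν (B ∩ invOrbitPreimage x E) ∂μ) / μ U :=
        ENNReal.div_le_div_right (setLIntegral_le_lintegral _ _) _
    _ = ν B * μ E / μ U := by
        rw [lintegral_measure_inter_invOrbitPreimage μ ν hBm hE]
    _ = ν B / μ U * μ E := ENNReal.mul_div_right_comm

/-- **Domination of orbit integrals with its constant, uniformly over left translates**:
`∫_D F(θ h⁻¹ • x₀) dν(h) ≤ (ν(closure (B' D)) / μ(B'° • x₀)) ∫_X F dμ` for every `θ ∈ G`, every
`D ⊆ G`, every neighbourhood `B'` of `1` and every measurable `F ≥ 0`. [folklore] -/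
theorem lintegral_smul_inv_smul_le_mul {x₀ : X} (hx₀ : IsOpenMap fun g : G => g • x₀)
    {B' : Set G} (hB'1 : B' ∈ 𝓝 (1 : G)) (D : Set G) {F : X → ℝ≥0∞} (hF : Measurable F) (θ : G) :
    ∫⁻ g in D, F (θ • g⁻¹ • x₀) ∂ν ≤
      ν (closure (B' * D)) / μ ((fun g : G => g • x₀) '' interior B') * ∫⁻ x, F x ∂μ :=
  lintegral_smul_inv_smul_le μ ν
    (fun _ hE => measure_inter_invOrbitPreimage_le_mul μ ν hx₀ hB'1 D hE) hF θ

/-- Real-valued form, for integrable `F ≥ 0` and `ν(closure (B' D)) < ∞`: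
`∫_D F(θ h⁻¹ • x₀) dν(h) ≤ (ν(closure (B' D)) / μ(B'° • x₀)).toReal ∫_X F dμ`. [folklore] -/
theorem integral_smul_inv_smul_le_mul {x₀ : X} (hx₀ : IsOpenMap fun g : G => g • x₀)
    {B' : Set G} (hB'1 : B' ∈ 𝓝 (1 : G)) {D : Set G} (hD : ν (closure (B' * D)) ≠ ∞)
    {F : X → ℝ} (hF : Measurable F) (hF0 : 0 ≤ F) (hFi : Integrable F μ) (θ : G) :
    ∫ g in D, F (θ • g⁻¹ • x₀) ∂ν ≤
      (ν (closure (B' * D)) / μ ((fun g : G => g • x₀) '' interior B')).toReal *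
        ∫ x, F x ∂μ :=
  integral_smul_inv_smul_le μ ν
    (ENNReal.div_ne_top hD (measure_orbitNhd_pos μ hx₀ hB'1).ne')
    (fun _ hE => measure_inter_invOrbitPreimage_le_mul μ ν hx₀ hB'1 D hE) hF hF0 hFi θ

end Explicit

end Literature.NumberTheory.Automorphic
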